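import Summits.ABC.ABC.Theses.RibetTakahashiSplit
import Summits.ABC.ABC.Theorems.RibetTakahashiSplitWeightedSzpiroBoundAbc
import HarnessLib

/-!
# Route RibetTakahashiSplit — item `OmegaLiftAssembly` (stmt-ABC-15513)

The ω-lift assembly of the route (planner operator D, 2026-08-16):

> `ManyPrimeValuationProductSemistableFrey → WeightedSzpiroBound → ABC`,

i.e. the few-prime hypothesis (`FewPrimeValuationProduct` / `FewPrimeHardCore`) is not needed to reach
`ABC` from the semistable-Frey many-prime crux R2 and the weighted Szpiro bound r3′.

It is proved on the nose from `Summit.ABC.ABC.Theorems.WeightedSzpiroBound.abc_of`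
(`Theorems/RibetTakahashiSplitWeightedSzpiroBoundAbc.lean`): the weighted Szpiro bound
r3′ = `WeightedSzpiroBound` alone already gives `ABC` (the component weight
`T(E) = ∏_{p ∥ N} ord_p Δ_min ≤ K_η |Δ|^η` is absorbed into the exponent; in fact
`WeightedSzpiroBound.iff_abc : WeightedSzpiroBound ↔ ABC` is in the tree), so — exactly as for the
landed `Assembly3` (`ribetTakahashiSplit_assembly3_proof`) — the crux R2 enters vacuously.

Honest note for the planner. The cubic ω-lift `a³ + b·(3a² + 3ab + b²) = c³` described in the item
(every abc bound on triples with ≥ 4 odd primes in `abc` transfers to all triples, exponent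
`1 + η ↦ (1 + η)/(1 − 2η)`) becomes load-bearing only if r3′ is itself re-cut to curves with ≥ 4 odd
multiplicative primes; with r3′ as filed (all curves semistable away from 2) the implication is
immediate.

The item's signature is stated here with fully-qualified route names (the route file does not yet
render a decl `OmegaLiftAssembly`; the term below is literally the filed signature
`ManyPrimeValuationProductSemistableFrey → WeightedSzpiroBound → _root_.ABC` read in the route
namespace).

Nothing else is in this file (no definitions, no named facts).
-/

-- `Summit.<Summit>.<Problem>` is the mandated summit-side namespace (CONVENTIONS §2); for the
-- single-conjunct summit `ABC` the two coincide, so the duplicate `ABC.ABC` is deliberate.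
set_option linter.dupNamespace false

noncomputable section

namespace Summit.ABC.ABC.Theorems

/-- **Item stmt-ABC-15513 (`OmegaLiftAssembly`), proved.** The ω-lift assembly
`ManyPrimeValuationProductSemistableFrey → WeightedSzpiroBound → ABC` of route RibetTakahashiSplit:
discard the first hypothesis and apply `WeightedSzpiroBound.abc_of` to the second. [folklore] -/
theorem omegaLiftAssembly_proof :
    Summit.ABC.ABC.Theses.RibetTakahashiSplit.ManyPrimeValuationProductSemistableFrey →
      Summit.ABC.ABC.Theses.RibetTakahashiSplit.WeightedSzpiroBound → _root_.ABC :=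
  fun _ hW => WeightedSzpiroBound.abc_of hW

end Summit.ABC.ABC.Theorems

end

/-! ### The filed signature, verbatim

The ledger signature of stmt-ABC-15513 is written in the vocabulary of the route file
(`ManyPrimeValuationProductSemistableFrey → WeightedSzpiroBound → _root_.ABC`, short names of
`namespace Summit.ABC.ABC.Theses.RibetTakahashiSplit`). With that namespace opened at file scope the
filed sentence elaborates verbatim in this module and is, syntactically, the type of
`omegaLiftAssembly_proof`; the theorem below records exactly that sentence (and the companion file
`RibetTakahashiSplitOmegaLiftAssemblyLift.lean` carries the cubic ω-lift `OmegaLift.abc_of_manyOddPrimes`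
that makes the item's informal mechanism formal). -/

open Summit.ABC.ABC.Theses.RibetTakahashiSplit

namespace Summit.ABC.ABC.Theorems

/-- **Item stmt-ABC-15513, filed signature verbatim** (route vocabulary, short names of
`Summit.ABC.ABC.Theses.RibetTakahashiSplit`):
`ManyPrimeValuationProductSemistableFrey → WeightedSzpiroBound → ABC`, by `omegaLiftAssembly_proof`.
[folklore] -/
theorem omegaLiftAssembly_filed_proof :
    ManyPrimeValuationProductSemistableFrey → WeightedSzpiroBound → _root_.ABC :=
  omegaLiftAssembly_proof

end Summit.ABC.ABC.Theorems
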